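import Summits.BirchSwinnertonDyer.BirchSwinnertonDyer.Theorems.SoloInformedJointGrossZagier
import Literature.NumberTheory.EllipticCurves.RegulatorBasisProofs
import Literature.NumberTheory.EllipticCurves.RegulatorProofs
import Mathlib.LinearAlgebra.FreeModule.Finite.CardQuotient
import HarnessLib

/-!
# Gross's `R = det⟨Pᵢ,Pⱼ⟩ / I²`: the regulator of a full-rank family of points is
# `[E(K)/tors : ⟨P̄ᵢ⟩]² · Reg(E/K)` (row T-MIL-R2, FILE J-1a; seat n1011-p01 GEN 9)

HONEST FRAMING (cell `b2b-bsdres`, run/shared/lean/b2b/bsd-rank1-residual/, verbatim in every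
file): the goal of the cell is to DELETE the COMBINATION-SHAPED residual classes of the
Birch–Swinnerton-Dyer formula for ALL analytic-rank `≤ 1` elliptic curves over `ℚ` — "full BSD
formula for every rank `≤ 1` curve in class `C`" assembled STRICTLY from published theorems — so
that the rank-`≤ 1` remainder becomes exactly the CONSTRUCTION-SHAPED classes, which are TYPED
(missing-input `Prop`s), NOT attempted. This is not "finishing BSD". Sub-classes X3♯(M) / X4(M)
(additive, potentially multiplicative prime; base-change-and-descend): a RESEARCH ROUTE; they stay
CONSTRUCTION-SHAPED; nothing is booked by this file; no mark / label moved. THEOREMS ONLY: no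
definition, no named fact, no `sorry`.

## What (row T-MIL-R2, `cells/n1011/skel/T-MIL-R2.md` §1, FILE J-1a)

The TOOL behind the any-rank regulator comparison under quadratic base change (FILE J-1b
`QuadraticBaseChangeRegulatorAnyRank`): the regulator of an arbitrary full-rank family of points
versus the regulator of a Mordell–Weil basis — Gross's remark after Definition 1.6 of his PCMI
lectures ("`R(E/k) = det(⟨Pᵢ,Pⱼ⟩)/I²` … does not depend on the choice of the points `Pᵢ`"), in
the tree's normalisation `Reg = det⟨Pᵢ,Pⱼ⟩` on a Mordell–Weil basis (`WeierstrassCurve.regulator`):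

* §0 lattice algebra (`ℤ`-bilinear forms on a free abelian group `N` with a finite basis `b`):
  `det_gram_eq_sq_det_mul_det_gram` — `det β(dᵢ,dⱼ) = (det_b d)² · det β(bᵢ,bⱼ)` for ANY family
  `d` on the index type of `b` (the tree's `det_gram_eq_of_basis` is the case `d` a basis);
  `index_closure_range_eq_natAbs_det` — `[N : ⟨d⟩] = |det_b d|` for `d` linearly independent
  (Mathlib `AddSubgroup.index_eq_natAbs_det`); `index_dvd_pow_of_smul_mem` — `[N : L] ∣ |m|^{rank N}`
  when `m · N ⊆ L`.
* §1 elliptic curves over a number field: **`regulatorOf_eq_index_sq_mul_regulator` — for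
  `Q : ι → E(K)` with `#ι = rank E(K)` and classes `Q̄ᵢ` independent in `E(K)/tors`,
  `det⟨Qᵢ,Qⱼ⟩ = [E(K)/tors : ⟨Q̄ᵢ⟩]² · Reg(E/K)`**, and `index_dvd_pow_mordellWeilRank_of_smul_mem`
  (`[E(K)/tors : L] ∣ |m|^{rank}` when `m · (E(K)/tors) ⊆ L`). Independence modulo torsion from
  `det⟨Qᵢ,Qⱼ⟩ ≠ 0` is the TREE's `soloInformedJoint_linearIndependent_of_regulatorOf_ne_zero`
  (`Summits/BirchSwinnertonDyer/BirchSwinnertonDyer/Theorems/SoloInformedJointGrossZagier`, imported,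
  not restated).

HONEST LIMITS: pure algebra on top of the tree's height theory (`exists_bilinMap_heightPairing`,
`IsMordellWeilBasis.regulatorOf_eq_regulator`, `exists_isMordellWeilBasis_holds`); TOOL theorems;
closes no class; moves no mark; no named fact.

References: B. H. Gross, *Lectures on the conjecture of Birch and Swinnerton-Dyer*, PCMI 18
(2011), Lecture 1 §4, Def. 1.6 and the remark following it [Gross2011]; J. H. Silverman, *AEC*
2nd ed., VIII.9: Thm. 9.3, Prop. 9.6, Cor. 9.7, Definition of `R_{E/K}` [SilvermanAEC2009].
-/

noncomputable section

open scoped Classical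

/-! ## §0 Lattice algebra: Gram determinants and indices of full-rank subfamilies -/

namespace Summit.BirchSwinnertonDyer.Rank1Residual.AdditivePotMult

section Lattice

variable {N S ι : Type*} [AddCommGroup N] [CommRing S] [Fintype ι] [DecidableEq ι]

/-- **Gram determinant of an arbitrary family against a basis.** For a `ℤ`-bilinear form `β` on a
free abelian group `N` with finite `ℤ`-basis `b` and ANY family `d : ι → N` on the same index type,
`det (β dᵢ dⱼ) = (det_b d)² · det (β bᵢ bⱼ)`: the Gram matrices satisfy `Gram_d = Aᵀ · Gram_b · A`
with `A = b.toMatrix d` the coordinate matrix of `d` (`dⱼ = ∑ₖ A k j • bₖ`, `Module.Basis.sum_repr`),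
and `det_b d = det A` (`Module.Basis.det_apply`). For `d` a second basis this is the tree's
`det_gram_eq_of_basis` (`det A = ±1`). The linear algebra behind Gross's "`R(E/k) =
det(⟨Pᵢ,Pⱼ⟩)/I²` does not depend on the choice of the points `Pᵢ`" (Lecture 1 §4, Def. 1.6).
[folklore] -/
theorem det_gram_eq_sq_det_mul_det_gram (β : N →ₗ[ℤ] N →ₗ[ℤ] S) (b : Module.Basis ι ℤ N)
    (d : ι → N) :
    (Matrix.of fun i j => β (d i) (d j)).det =
      ((b.det d : ℤ) : S) ^ 2 * (Matrix.of fun i j => β (b i) (b j)).det := by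
  set A : Matrix ι ι ℤ := b.toMatrix d with hA
  set f : ℤ →+* S := Int.castRingHom S
  have hmat : (Matrix.of fun i j => β (d i) (d j)) =
      f.mapMatrix A.transpose * (Matrix.of fun i j => β (b i) (b j)) * f.mapMatrix A := by
    ext i j
    conv_lhs => rw [Matrix.of_apply, ← b.sum_repr (d i), ← b.sum_repr (d j)]
    simp only [map_sum, map_zsmul, zsmul_eq_mul, LinearMap.coe_sum, Finset.sum_apply,
      LinearMap.smul_apply, Matrix.mul_apply, RingHom.mapMatrix_apply, Matrix.map_apply,
      Matrix.transpose_apply, Matrix.of_apply, hA, Module.Basis.toMatrix_apply, f, eq_intCast,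
      Finset.sum_mul, Finset.mul_sum]
    refine Finset.sum_congr rfl fun l _ => Finset.sum_congr rfl fun k _ => ?_
    ring
  rw [hmat, Matrix.det_mul, Matrix.det_mul, ← RingHom.map_det, ← RingHom.map_det,
    Matrix.det_transpose, Module.Basis.det_apply]
  simp only [f, eq_intCast]
  ring

/-- **The index of the subgroup generated by a linearly independent full-rank family is the
absolute determinant of its coordinate matrix**: for a `ℤ`-basis `b : ι → N` and `d : ι → N`
linearly independent, `[N : ⟨d⟩] = |det_b d|` (Mathlib `AddSubgroup.index_eq_natAbs_det` with the
basis `Module.Basis.span` of `⟨d⟩ = span_ℤ d`). Gross (2011), Lecture 1 §4 (the index `I` of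
Def. 1.6). [folklore] -/
theorem index_closure_range_eq_natAbs_det (b : Module.Basis ι ℤ N) {d : ι → N}
    (hd : LinearIndependent ℤ d) :
    (AddSubgroup.closure (Set.range d)).index = (b.det d).natAbs := by
  rw [← Submodule.span_int_eq_addSubgroupClosure, AddSubgroup.index_eq_natAbs_det b
    (Submodule.span ℤ (Set.range d)).toAddSubgroup
    ((Module.Basis.span hd).map (LinearEquiv.refl ℤ _))]
  congr 2
  funext i
  change ((Module.Basis.span hd) i : N) = d i
  rw [Module.Basis.span_apply hd i]

omit [DecidableEq ι] in
/-- A nonzero integer multiple of a `ℤ`-basis is still linearly independent (torsion-freeness of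
`ℤ`). [folklore] -/
theorem linearIndependent_smul_basis (b : Module.Basis ι ℤ N) {m : ℤ} (hm : m ≠ 0) :
    LinearIndependent ℤ (fun i => m • b i) := by
  rw [Fintype.linearIndependent_iff]
  intro g hg i
  have h0 : ∑ j, (g j * m) • b j = 0 := by
    simpa only [mul_smul] using hg
  have := (Fintype.linearIndependent_iff.mp b.linearIndependent) (fun j => g j * m) h0 i
  exact (mul_eq_zero.mp this).resolve_right hm

/-- **An additive subgroup containing `m · N` has index dividing `m^{rank N}`**: if `b : ι → N` is a
`ℤ`-basis and `m • x ∈ L` for every `x`, then `[N : L] ∣ |m|^{#ι}` — `L ⊇ ⟨m bᵢ⟩`, whose index is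
`|det_b (m b)| = |m|^{#ι}` (`index_closure_range_eq_natAbs_det`, multilinearity of `det_b`).
[folklore] -/
theorem index_dvd_pow_of_smul_mem (b : Module.Basis ι ℤ N) (L : AddSubgroup N) {m : ℤ}
    (hm : m ≠ 0) (hL : ∀ x : N, m • x ∈ L) : L.index ∣ m.natAbs ^ Fintype.card ι := by
  have hle : AddSubgroup.closure (Set.range fun i => m • b i) ≤ L := by
    rw [AddSubgroup.closure_le]
    rintro _ ⟨i, rfl⟩
    exact hL (b i)
  have hidx := index_closure_range_eq_natAbs_det b (linearIndependent_smul_basis b hm)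
  have hdet : b.det (fun i => m • b i) = m ^ Fintype.card ι := by
    have h := (b.det : MultilinearMap ℤ (fun _ : ι => N) ℤ).map_smul_univ (fun _ => m) b
    rw [Finset.prod_const, Finset.card_univ, smul_eq_mul] at h
    change b.det (fun i => m • b i) = m ^ Fintype.card ι * b.det b at h
    rw [h, Module.Basis.det_self, mul_one]
  rw [hdet, Int.natAbs_pow] at hidx
  rw [← hidx]
  exact AddSubgroup.index_dvd_of_le hle

end Lattice

/-! ## §1 Gross's `R = det⟨Pᵢ,Pⱼ⟩ / I²` for elliptic curves over a number field -/

section NumberField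

open WeierstrassCurve Affine.Point Literature.NumberTheory.EllipticCurves

variable {K : Type*} [Field K] [NumberField K] {W : WeierstrassCurve K}

/-- **Gross's remark after Definition 1.6, in the tree's normalisation: `det⟨Qᵢ,Qⱼ⟩ =
[E(K)/tors : ⟨Q̄ᵢ⟩]² · Reg(E/K)`** for an elliptic curve over a number field and any family
`Q : ι → E(K)` with `#ι = rank E(K)` whose classes `Q̄ᵢ ∈ E(K)/tors` are `ℤ`-linearly independent
(so `⟨Q̄ᵢ⟩` has finite index). Proof: against a Mordell–Weil basis `b` (`exists_isMordellWeilBasis_holds`,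
reindexed along `ι ≃ Fin r`) the descended pairing `β` (`exists_bilinMap_heightPairing`) has
`det β(Q̄ᵢ,Q̄ⱼ) = (det_b Q̄)² · det β(bᵢ,bⱼ)` (§0), `det β(bᵢ,bⱼ) = Reg(E/K)`
(`IsMordellWeilBasis.regulatorOf_eq_regulator`) and `[E(K)/tors : ⟨Q̄⟩] = |det_b Q̄|` (§0).
Gross writes `R(E/k) = det(⟨Pᵢ,Pⱼ⟩)/I²` with `I` the index in `E(k)`; the tree's `regulator` is
Gross's `R · #E(k)_tors²`, and for classes independent modulo torsion `I = #E(k)_tors · [E(k)/tors : ⟨P̄ᵢ⟩]`.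
[cite: Gross2011, Lecture 1 §4, Def. 1.6] -/
theorem regulatorOf_eq_index_sq_mul_regulator [W.IsElliptic] {ι : Type*} [Fintype ι]
    [DecidableEq ι] {Q : ι → W.toAffine.Point}
    (hli : LinearIndependent ℤ (QuotientAddGroup.mk ∘ Q : ι → mordellWeilModTorsion W))
    (hcard : Fintype.card ι = W.mordellWeilRank) :
    regulatorOf Q =
      ((AddSubgroup.closure (Set.range (QuotientAddGroup.mk ∘ Q : ι → mordellWeilModTorsion W))).index
          : ℝ) ^ 2 * W.regulator := by
  -- a Mordell–Weil basis, reindexed by `ι`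
  obtain ⟨P, hP⟩ := exists_isMordellWeilBasis_holds W
  let b₀ : Module.Basis (Fin W.mordellWeilRank) ℤ (mordellWeilModTorsion W) :=
    Module.Basis.mk hP.1 hP.2.ge
  have hb₀ : ∀ i, b₀ i = QuotientAddGroup.mk (P i) := fun i => Module.Basis.mk_apply _ _ i
  let e : ι ≃ Fin W.mordellWeilRank := Fintype.equivFinOfCardEq hcard
  let b : Module.Basis ι ℤ (mordellWeilModTorsion W) := b₀.reindex e.symm
  have hb : ∀ i, b i = QuotientAddGroup.mk (P (e i)) := fun i => by
    rw [Module.Basis.reindex_apply, Equiv.symm_symm, hb₀]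
  -- the descended pairing
  obtain ⟨β, hβ⟩ := exists_bilinMap_heightPairing (W := W)
  have hRQ : regulatorOf Q =
      (Matrix.of fun i j => β (QuotientAddGroup.mk (Q i)) (QuotientAddGroup.mk (Q j))).det :=
    regulatorOf_eq_det_of_bilinMap hβ Q (QuotientAddGroup.mk ∘ Q) fun _ => rfl
  have hRb : (Matrix.of fun i j => β (b i) (b j)).det = W.regulator := by
    rw [← regulatorOf_eq_det_of_bilinMap hβ (P ∘ e) b (fun i => hb i)]
    have := regulatorOf_reindex e.symm P
    rw [Equiv.symm_symm] at this
    rw [this, hP.regulatorOf_eq_regulator]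
  have key := det_gram_eq_sq_det_mul_det_gram β b (QuotientAddGroup.mk ∘ Q)
  simp only [Function.comp_apply] at key
  rw [hRQ, key, hRb, index_closure_range_eq_natAbs_det b hli, Nat.cast_natAbs, Int.cast_abs,
    sq_abs]

/-- **The index of a subgroup of `E(K)/tors` containing `m · (E(K)/tors)` divides `m^{rank E(K)}`**
(`m ≠ 0`): §0 `index_dvd_pow_of_smul_mem` against a Mordell–Weil basis
(`exists_isMordellWeilBasis_holds`; `#basis = rank`, `IsMordellWeilBasis.card_eq_holds`).
[folklore] -/
theorem index_dvd_pow_mordellWeilRank_of_smul_mem [W.IsElliptic] (L : AddSubgroup (mordellWeilModTorsion W))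
    {m : ℤ} (hm : m ≠ 0) (hL : ∀ x : mordellWeilModTorsion W, m • x ∈ L) :
    L.index ∣ m.natAbs ^ W.mordellWeilRank := by
  obtain ⟨P, hP⟩ := exists_isMordellWeilBasis_holds W
  let b : Module.Basis (Fin W.mordellWeilRank) ℤ (mordellWeilModTorsion W) :=
    Module.Basis.mk hP.1 hP.2.ge
  have h := index_dvd_pow_of_smul_mem b L hm hL
  rwa [Fintype.card_fin] at h

end NumberField

end Summit.BirchSwinnertonDyer.Rank1Residual.AdditivePotMult

end
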